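import Summits.NavierStokesRegularity.NavierStokesRegularity.Theorems.SymmetryModuliCountSymmetricLiouvilleOseenBootstrapTools
import HarnessLib

/-!
# Route `SymmetryModuliCount`, crux `SymmetricLiouville` (stmt-NavierStokesRegularity-4053), line `blowdown-kills-pitch`:
# the symmetry-free Oseen bootstrap B2 from its five analysis stubs (stub T6, the integration)

Summits-side theorem file (kind = proof, no definitions). For a Type-I ancient mild solution `u ∈ A_C`
(`IsTypeIAncientMild C u`) whose scale-invariant size `√(−t)‖u(t,x)‖` is small outside the paraboloids
`‖x‖ ≥ R√(−t)`, we derive the space–time Type-I bound `‖u(t,x)‖ ≤ K/(‖x‖ + √(−t))` (`HasTypeIDecay K u`,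
Pineau–Vicol's class (1.10)) from five self-contained analysis statements taken as hypotheses (each a registered
stub of the line, landed separately): T1 the ancient Oseen inequality
`‖u(t,x)‖ ≤ C₀∫_{τ<t}∫(t−τ+‖x−y‖²)^{-2}‖u(τ,y)‖²dydτ`; T2 the kernel against the temporal weight
`∫_{τ<t}∫(t−τ+‖x−y‖²)^{-2}(−τ)^{-1} ≤ A/√(−t)`; T3 the slab (Fubini) bound; T4 the crossing-time integral;
T5 the envelope functional inequality ⇒ critical rate.

The integration (this file): the far-field envelope `m(L) = sup{√(−t)‖u(t,x)‖ : ‖x‖ ≥ L√(−t)}` is antitone,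
bounded by `C`, and tends to `0`; at a point with `‖x‖ = L'√(−t)`, `L' ≥ L > 0`, the sources of T1 are split
along the slab `|⟪y,x⟫| ≤ (L/4)√(−τ)‖x‖`: off the slab `‖u‖² ≤ m(L/4)²/(−τ)` (T2), on the slab
`‖u(τ,y)‖² ≤ m(|y₁|/√(−τ))²/(−τ)` with `y₁ = ⟪y,x⟫/‖x‖` (T3, the substitution `y₁ = ρ√(−τ)`, Tonelli, T4),
which yields the master inequality `m(L) ≤ A₁m(L/4)² + (A₂/L)∫₀^{L/4}m²` of T5; `m(L) ≤ K/L` and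
`‖u‖ ≤ C/√(−t)` give `HasTypeIDecay (2 max C K) u`.

References: Koch–Nadirashvili–Seregin–Šverák, Acta Math. 203 (2009) = arXiv:0709.3599, §4 (the Oseen kernel
bound (3.8), (4.3)–(4.4)); Koch–Tataru, Adv. Math. 157 (2001), (14); Pineau–Vicol arXiv:2607.09619, (1.9)–(1.10).
-/

noncomputable section

set_option linter.dupNamespace false

open Set Function Filter MeasureTheory
open scoped Topology ENNReal
open Literature.Analysis.FluidPDE

namespace Summit.NavierStokesRegularity.NavierStokesRegularity.Theorems.SymmetryModuliCountSymmetricLiouville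

/-- Local notation for physical space `ℝ³` (the registered stub signature is written with it). -/
local notation "E3" => EuclideanSpace ℝ (Fin 3)

/-! ## The master inequality at one point -/

/-- **The master inequality at a far point.** Under T1–T4 (as hypotheses, with their constants) and for an
envelope `m` (measurable, nonnegative) dominating the scale-invariant size, `√(−τ)‖u(τ,y)‖ ≤ m(L)` whenever
`‖y‖ ≥ L√(−τ)`: at every point with `‖x‖ ≥ L√(−t)`, `L > 0`,
`√(−t)‖u(t,x)‖ ≤ C₀A₂ m(L/4)² + (2C₀A₃A₄/L) ∫₀^{L/4} m²`. [cite: KochNadirashviliSereginSverak2009, §4 (4.3)–(4.4) (arXiv:0709.3599 p. 8)] -/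
theorem master_inequality_at {u : ℝ → EuclideanSpace ℝ (Fin 3) → EuclideanSpace ℝ (Fin 3)} {C₀ A₂ A₃ A₄ : ℝ} (hC₀ : 0 < C₀) (hA₂ : 0 < A₂) (hA₃ : 0 < A₃)
    (hA₄ : 0 < A₄)
    (h1 : ∀ t < 0, ∀ x : EuclideanSpace ℝ (Fin 3), ENNReal.ofReal ‖u t x‖ ≤ ENNReal.ofReal C₀ *
      ∫⁻ τ in Iio t, ∫⁻ y, ENNReal.ofReal ((t - τ + ‖x - y‖ ^ 2)⁻¹ ^ 2 * ‖u τ y‖ ^ 2))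
    (h2 : ∀ t < 0, ∀ x : EuclideanSpace ℝ (Fin 3),
      ∫⁻ τ in Iio t, ∫⁻ y, ENNReal.ofReal ((t - τ + ‖x - y‖ ^ 2)⁻¹ ^ 2 * (-τ)⁻¹) ≤
        ENNReal.ofReal (A₂ / Real.sqrt (-t)))
    (h3 : ∀ x : EuclideanSpace ℝ (Fin 3), x ≠ 0 → ∀ σ : ℝ, 0 < σ → ∀ (a : ℝ) (F : ℝ → ℝ≥0∞), Measurable F →
      ∫⁻ y in {y : EuclideanSpace ℝ (Fin 3) | |inner ℝ y x| ≤ a * ‖x‖},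
          ENNReal.ofReal ((σ + ‖x - y‖ ^ 2)⁻¹ ^ 2) * F (inner ℝ y x / ‖x‖) ≤
        ENNReal.ofReal A₃ * ∫⁻ r in Icc (-a) a, ENNReal.ofReal ((σ + (‖x‖ - r) ^ 2)⁻¹) * F r)
    (h4 : ∀ s₀ : ℝ, 0 < s₀ → ∀ X : ℝ, 0 < X → ∀ ρ : ℝ, |ρ| * (4 * Real.sqrt s₀) ≤ X →
      ∫⁻ s in Ioi s₀, ENNReal.ofReal ((Real.sqrt s)⁻¹ * (s - s₀ + (X - ρ * Real.sqrt s) ^ 2)⁻¹) ≤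
        ENNReal.ofReal (A₄ / X))
    {m : ℝ → ℝ} (hmeas : Measurable m) (hm0 : ∀ L, 0 ≤ m L) (hanti : Antitone m)
    (hub : ∀ L, ∀ τ < 0, ∀ y : EuclideanSpace ℝ (Fin 3), L * Real.sqrt (-τ) ≤ ‖y‖ → Real.sqrt (-τ) * ‖u τ y‖ ≤ m L)
    {L : ℝ} (hL : 0 < L) {t : ℝ} (ht : t < 0) {x : EuclideanSpace ℝ (Fin 3)} (hx : L * Real.sqrt (-t) ≤ ‖x‖) :
    Real.sqrt (-t) * ‖u t x‖ ≤
      C₀ * A₂ * m (L / 4) ^ 2 + 2 * C₀ * A₃ * A₄ / L * ∫ s in (0:ℝ)..(L / 4), m s ^ 2 := by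
  -- abbreviations
  have hs₀ : 0 < Real.sqrt (-t) := Real.sqrt_pos.2 (neg_pos.2 ht)
  have hX : 0 < ‖x‖ := lt_of_lt_of_le (mul_pos hL hs₀) hx
  have hx0 : x ≠ 0 := norm_pos_iff.1 hX
  -- the square of the envelope bound: `‖u τ y‖² ≤ m(ℓ)² (−τ)⁻¹` when `ℓ√(−τ) ≤ ‖y‖`
  have hsq : ∀ ℓ, ∀ τ < 0, ∀ y : EuclideanSpace ℝ (Fin 3), ℓ * Real.sqrt (-τ) ≤ ‖y‖ → ‖u τ y‖ ^ 2 ≤ m ℓ ^ 2 * (-τ)⁻¹ := by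
    intro ℓ τ hτ y hy
    have hsτ : 0 < Real.sqrt (-τ) := Real.sqrt_pos.2 (neg_pos.2 hτ)
    have h := hub ℓ τ hτ y hy
    have h' : ‖u τ y‖ ≤ m ℓ / Real.sqrt (-τ) := by
      rw [le_div_iff₀ hsτ, mul_comm]; exact h
    calc ‖u τ y‖ ^ 2 ≤ (m ℓ / Real.sqrt (-τ)) ^ 2 := pow_le_pow_left₀ (norm_nonneg _) h' 2
      _ = m ℓ ^ 2 * (-τ)⁻¹ := by
        rw [div_pow, Real.sq_sqrt (neg_pos.2 hτ).le, div_eq_mul_inv]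
  -- the slab half-width, the sheet weight, the kernel majorant
  set a : ℝ → ℝ := fun τ => L / 4 * Real.sqrt (-τ) with ha
  set F : ℝ → ℝ → ℝ≥0∞ := fun τ r => ENNReal.ofReal (m (|r| / Real.sqrt (-τ)) ^ 2 * (-τ)⁻¹) with hF
  have hFmeas : ∀ τ, Measurable (F τ) := fun τ =>
    (((hmeas.comp (measurable_id.abs.div_const _)).pow_const 2).mul_const _).ennreal_ofReal
  set k : ℝ → EuclideanSpace ℝ (Fin 3) → ℝ := fun τ y => (t - τ + ‖x - y‖ ^ 2)⁻¹ ^ 2 with hk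
  have hk0 : ∀ τ y, 0 ≤ k τ y := fun τ y => by positivity
  -- Step A: the pointwise source bound for `τ < t`
  have hA : ∀ τ < t, ∀ y : EuclideanSpace ℝ (Fin 3),
      ENNReal.ofReal (k τ y * ‖u τ y‖ ^ 2) ≤
        ENNReal.ofReal (m (L / 4) ^ 2) * ENNReal.ofReal (k τ y * (-τ)⁻¹) +
          {y : EuclideanSpace ℝ (Fin 3) | |inner ℝ y x| ≤ a τ * ‖x‖}.indicator
            (fun y => ENNReal.ofReal (k τ y) * F τ (inner ℝ y x / ‖x‖)) y := by
    intro τ hτ y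
    have hτ0 : τ < 0 := hτ.trans ht
    have hsτ : 0 < Real.sqrt (-τ) := Real.sqrt_pos.2 (neg_pos.2 hτ0)
    have hCS : |inner ℝ y x| ≤ ‖y‖ * ‖x‖ := abs_real_inner_le_norm y x
    by_cases hy : y ∈ {y : EuclideanSpace ℝ (Fin 3) | |inner ℝ y x| ≤ a τ * ‖x‖}
    · -- on the slab: `ℓ = |y₁|/√(−τ)` has `ℓ√(−τ) = |y₁| ≤ ‖y‖`
      rw [indicator_of_mem hy]
      refine le_add_left ?_
      have hy1 : |inner ℝ y x / ‖x‖| ≤ ‖y‖ := by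
        rw [abs_div, abs_of_pos hX, div_le_iff₀ hX]
        exact hCS
      have hℓ : |inner ℝ y x / ‖x‖| / Real.sqrt (-τ) * Real.sqrt (-τ) ≤ ‖y‖ := by
        rw [div_mul_cancel₀ _ hsτ.ne']
        exact hy1
      have h := hsq _ τ hτ0 y hℓ
      calc ENNReal.ofReal (k τ y * ‖u τ y‖ ^ 2)
          ≤ ENNReal.ofReal (k τ y * (m (|inner ℝ y x / ‖x‖| / Real.sqrt (-τ)) ^ 2 * (-τ)⁻¹)) :=
            ENNReal.ofReal_le_ofReal (mul_le_mul_of_nonneg_left h (hk0 τ y))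
        _ = ENNReal.ofReal (k τ y) * F τ (inner ℝ y x / ‖x‖) := by
            rw [hF, ← ENNReal.ofReal_mul (hk0 τ y)]
    · -- off the slab: `‖y‖ > (L/4)√(−τ)`
      rw [indicator_of_notMem hy, add_zero]
      have hy' : a τ * ‖x‖ < |inner ℝ y x| := lt_of_not_ge hy
      have hyn : L / 4 * Real.sqrt (-τ) ≤ ‖y‖ := by
        have h1 : a τ * ‖x‖ < ‖y‖ * ‖x‖ := hy'.trans_le hCS
        exact (lt_of_mul_lt_mul_right h1 hX.le).le
      have h := hsq _ τ hτ0 y hyn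
      calc ENNReal.ofReal (k τ y * ‖u τ y‖ ^ 2)
          ≤ ENNReal.ofReal (k τ y * (m (L / 4) ^ 2 * (-τ)⁻¹)) :=
            ENNReal.ofReal_le_ofReal (mul_le_mul_of_nonneg_left h (hk0 τ y))
        _ = ENNReal.ofReal (m (L / 4) ^ 2) * ENNReal.ofReal (k τ y * (-τ)⁻¹) := by
            rw [← ENNReal.ofReal_mul (sq_nonneg _)]
            congr 1
            ring
  -- measurability of the two explicit pieces
  have hkw_meas : Measurable fun p : ℝ × EuclideanSpace ℝ (Fin 3) => ENNReal.ofReal (k p.1 p.2 * (-p.1)⁻¹) := by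
    have h := measurable_kernel_timeWeight t x
    simpa only [hk] using h
  have hkw_meas_slice : ∀ τ, Measurable fun y : EuclideanSpace ℝ (Fin 3) => ENNReal.ofReal (k τ y * (-τ)⁻¹) := fun τ => by
    have h := hkw_meas.comp (measurable_prodMk_left (x := τ))
    exact h
  -- the slabs are closed, hence measurable
  have hcont : Continuous fun y : EuclideanSpace ℝ (Fin 3) => inner ℝ y x := continuous_id.inner continuous_const
  have hslab : ∀ τ, MeasurableSet {y : EuclideanSpace ℝ (Fin 3) | |inner ℝ y x| ≤ a τ * ‖x‖} := fun τ =>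
    (isClosed_le hcont.abs continuous_const).measurableSet
  -- Step B: the inner integral
  have hB : ∀ τ < t,
      ∫⁻ y, ENNReal.ofReal (k τ y * ‖u τ y‖ ^ 2) ≤
        ENNReal.ofReal (m (L / 4) ^ 2) * (∫⁻ y, ENNReal.ofReal (k τ y * (-τ)⁻¹)) +
          ENNReal.ofReal A₃ * ∫⁻ r in Icc (-(a τ)) (a τ),
            ENNReal.ofReal ((t - τ + (‖x‖ - r) ^ 2)⁻¹) * F τ r := by
    intro τ hτ
    have hστ : 0 < t - τ := sub_pos.2 hτ
    calc ∫⁻ y, ENNReal.ofReal (k τ y * ‖u τ y‖ ^ 2)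
        ≤ ∫⁻ y, (ENNReal.ofReal (m (L / 4) ^ 2) * ENNReal.ofReal (k τ y * (-τ)⁻¹) +
            {y : EuclideanSpace ℝ (Fin 3) | |inner ℝ y x| ≤ a τ * ‖x‖}.indicator
              (fun y => ENNReal.ofReal (k τ y) * F τ (inner ℝ y x / ‖x‖)) y) :=
          lintegral_mono fun y => hA τ hτ y
      _ = ENNReal.ofReal (m (L / 4) ^ 2) * (∫⁻ y, ENNReal.ofReal (k τ y * (-τ)⁻¹)) +
            ∫⁻ y in {y : EuclideanSpace ℝ (Fin 3) | |inner ℝ y x| ≤ a τ * ‖x‖},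
              ENNReal.ofReal (k τ y) * F τ (inner ℝ y x / ‖x‖) := by
          rw [lintegral_add_left ((hkw_meas_slice τ).const_mul _), lintegral_const_mul _ (hkw_meas_slice τ),
            lintegral_indicator (hslab τ)]
      _ ≤ ENNReal.ofReal (m (L / 4) ^ 2) * (∫⁻ y, ENNReal.ofReal (k τ y * (-τ)⁻¹)) +
            ENNReal.ofReal A₃ * ∫⁻ r in Icc (-(a τ)) (a τ),
              ENNReal.ofReal ((t - τ + (‖x‖ - r) ^ 2)⁻¹) * F τ r :=
          add_le_add le_rfl (h3 x hx0 (t - τ) hστ (a τ) (F τ) (hFmeas τ))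
  -- Step C: integrate in `τ < t`, split, and use T2 on the first piece
  have hIτ_meas : Measurable fun τ =>
      ENNReal.ofReal (m (L / 4) ^ 2) * ∫⁻ y, ENNReal.ofReal (k τ y * (-τ)⁻¹) := by
    refine Measurable.const_mul ?_ _
    exact hkw_meas.lintegral_prod_right'
  have hk' : ∀ τ y, (t - τ + ‖x - y‖ ^ 2)⁻¹ ^ 2 = k τ y := fun τ y => rfl
  have h2' := h2 t ht x
  simp only [hk'] at h2'
  have hC : ∫⁻ τ in Iio t, ∫⁻ y, ENNReal.ofReal (k τ y * ‖u τ y‖ ^ 2) ≤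
      ENNReal.ofReal (m (L / 4) ^ 2) * ENNReal.ofReal (A₂ / Real.sqrt (-t)) +
        ENNReal.ofReal A₃ * ∫⁻ τ in Iio t, ∫⁻ r in Icc (-(a τ)) (a τ),
          ENNReal.ofReal ((t - τ + (‖x‖ - r) ^ 2)⁻¹) * F τ r := by
    calc ∫⁻ τ in Iio t, ∫⁻ y, ENNReal.ofReal (k τ y * ‖u τ y‖ ^ 2)
        ≤ ∫⁻ τ in Iio t, (ENNReal.ofReal (m (L / 4) ^ 2) * (∫⁻ y, ENNReal.ofReal (k τ y * (-τ)⁻¹)) +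
            ENNReal.ofReal A₃ * ∫⁻ r in Icc (-(a τ)) (a τ),
              ENNReal.ofReal ((t - τ + (‖x‖ - r) ^ 2)⁻¹) * F τ r) :=
          setLIntegral_mono' measurableSet_Iio fun τ hτ => hB τ hτ
      _ = ENNReal.ofReal (m (L / 4) ^ 2) * (∫⁻ τ in Iio t, ∫⁻ y, ENNReal.ofReal (k τ y * (-τ)⁻¹)) +
            ENNReal.ofReal A₃ * ∫⁻ τ in Iio t, ∫⁻ r in Icc (-(a τ)) (a τ),
              ENNReal.ofReal ((t - τ + (‖x‖ - r) ^ 2)⁻¹) * F τ r := by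
          rw [lintegral_add_left hIτ_meas, lintegral_const_mul' _ _ ENNReal.ofReal_ne_top,
            lintegral_const_mul' _ _ ENNReal.ofReal_ne_top]
      _ ≤ ENNReal.ofReal (m (L / 4) ^ 2) * ENNReal.ofReal (A₂ / Real.sqrt (-t)) +
            ENNReal.ofReal A₃ * ∫⁻ τ in Iio t, ∫⁻ r in Icc (-(a τ)) (a τ),
              ENNReal.ofReal ((t - τ + (‖x‖ - r) ^ 2)⁻¹) * F τ r :=
          add_le_add (mul_le_mul' le_rfl h2') le_rfl
  -- Step D: the substitution `r = ρ√(−τ)` in the sheet integral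
  set Φ : ℝ × ℝ → ℝ≥0∞ := fun p =>
    ENNReal.ofReal (m |p.2| ^ 2) *
      ENNReal.ofReal ((Real.sqrt (-p.1))⁻¹ * (t - p.1 + (‖x‖ - p.2 * Real.sqrt (-p.1)) ^ 2)⁻¹) with hΦ
  have hΦmeas : Measurable Φ := by
    simpa only [hΦ] using measurable_sheet_integrand hmeas t ‖x‖
  have hD : ∀ τ < t, ∫⁻ r in Icc (-(a τ)) (a τ), ENNReal.ofReal ((t - τ + (‖x‖ - r) ^ 2)⁻¹) * F τ r =
      ∫⁻ ρ in Icc (-(L / 4)) (L / 4), Φ (τ, ρ) := by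
    intro τ hτ
    have hτ0 : 0 < -τ := by linarith
    have hsτ : 0 < Real.sqrt (-τ) := Real.sqrt_pos.2 hτ0
    have hS2 : Real.sqrt (-τ) * Real.sqrt (-τ) = -τ := Real.mul_self_sqrt hτ0.le
    have haτ : a τ = Real.sqrt (-τ) * (L / 4) := by simp only [ha]; ring
    rw [haτ, setLIntegral_Icc_comp_mul _ hsτ, ← lintegral_const_mul' _ _ ENNReal.ofReal_ne_top]
    refine setLIntegral_congr_fun measurableSet_Icc fun ρ _ => ?_
    simp only [hΦ, hF]
    rw [abs_mul, abs_of_pos hsτ, mul_div_cancel_left₀ _ hsτ.ne', ← ENNReal.ofReal_mul (by positivity),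
      ← ENNReal.ofReal_mul hsτ.le, ← ENNReal.ofReal_mul (sq_nonneg _)]
    congr 1
    have hinv : (-τ)⁻¹ = (Real.sqrt (-τ))⁻¹ * (Real.sqrt (-τ))⁻¹ := by rw [← mul_inv, hS2]
    rw [hinv, show ‖x‖ - Real.sqrt (-τ) * ρ = ‖x‖ - ρ * Real.sqrt (-τ) by ring]
    field_simp
  -- Step E: Tonelli
  have hE : ∫⁻ τ in Iio t, ∫⁻ r in Icc (-(a τ)) (a τ), ENNReal.ofReal ((t - τ + (‖x‖ - r) ^ 2)⁻¹) * F τ r =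
      ∫⁻ ρ in Icc (-(L / 4)) (L / 4), ∫⁻ τ in Iio t, Φ (τ, ρ) := by
    rw [setLIntegral_congr_fun measurableSet_Iio fun τ hτ => hD τ hτ]
    have hunc : (uncurry fun τ ρ => Φ (τ, ρ)) = Φ := by
      funext p
      rfl
    have hae : AEMeasurable (uncurry fun τ ρ => Φ (τ, ρ))
        ((volume.restrict (Iio t)).prod (volume.restrict (Icc (-(L / 4)) (L / 4)))) := by
      rw [hunc]
      exact hΦmeas.aemeasurable
    exact lintegral_lintegral_swap hae
  -- Step F: the crossing-time integral of each sheet (T4)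
  have hF' : ∀ ρ ∈ Icc (-(L / 4)) (L / 4),
      ∫⁻ τ in Iio t, Φ (τ, ρ) ≤ ENNReal.ofReal (m |ρ| ^ 2) * ENNReal.ofReal (A₄ / ‖x‖) := by
    intro ρ hρ
    have hρ' : |ρ| * (4 * Real.sqrt (-t)) ≤ ‖x‖ := by
      have h1 : |ρ| ≤ L / 4 := abs_le.2 ⟨hρ.1, hρ.2⟩
      calc |ρ| * (4 * Real.sqrt (-t)) ≤ L / 4 * (4 * Real.sqrt (-t)) :=
            mul_le_mul_of_nonneg_right h1 (by positivity)
        _ = L * Real.sqrt (-t) := by ring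
        _ ≤ ‖x‖ := hx
    simp only [hΦ]
    rw [lintegral_const_mul' _ _ ENNReal.ofReal_ne_top]
    refine mul_le_mul' le_rfl ?_
    rw [setLIntegral_Iio_eq_Ioi_neg]
    have h := h4 (-t) (neg_pos.2 ht) ‖x‖ hX ρ hρ'
    simp only [neg_neg, sub_neg_eq_add] at h ⊢
    refine le_trans (le_of_eq ?_) h
    refine setLIntegral_congr_fun measurableSet_Ioi fun s _ => ?_
    rw [show t + s = s + t from add_comm t s]
  -- Step G: assemble
  have h1' := h1 t ht x
  simp only [hk'] at h1'
  set I : ℝ := ∫ s in (0:ℝ)..(L / 4), m s ^ 2 with hI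
  have hI0 : 0 ≤ I := intervalIntegral.integral_nonneg (by positivity) fun s _ => sq_nonneg _
  have hJ : ∫⁻ τ in Iio t, ∫⁻ r in Icc (-(a τ)) (a τ), ENNReal.ofReal ((t - τ + (‖x‖ - r) ^ 2)⁻¹) * F τ r ≤
      2 * ENNReal.ofReal I * ENNReal.ofReal (A₄ / ‖x‖) := by
    rw [hE]
    calc ∫⁻ ρ in Icc (-(L / 4)) (L / 4), ∫⁻ τ in Iio t, Φ (τ, ρ)
        ≤ ∫⁻ ρ in Icc (-(L / 4)) (L / 4), ENNReal.ofReal (m |ρ| ^ 2) * ENNReal.ofReal (A₄ / ‖x‖) :=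
          setLIntegral_mono' measurableSet_Icc hF'
      _ = (∫⁻ ρ in Icc (-(L / 4)) (L / 4), ENNReal.ofReal (m |ρ| ^ 2)) * ENNReal.ofReal (A₄ / ‖x‖) :=
          lintegral_mul_const' _ _ ENNReal.ofReal_ne_top
      _ ≤ (2 * ∫⁻ ρ in Icc 0 (L / 4), ENNReal.ofReal (m ρ ^ 2)) * ENNReal.ofReal (A₄ / ‖x‖) :=
          mul_le_mul' (setLIntegral_Icc_abs_le (fun r => ENNReal.ofReal (m r ^ 2)) (L / 4)) le_rfl
      _ = 2 * ENNReal.ofReal I * ENNReal.ofReal (A₄ / ‖x‖) := by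
          rw [setLIntegral_Icc_sq_eq_ofReal hanti hm0 (by positivity : (0:ℝ) ≤ L / 4)]
  have h2I : 0 ≤ 2 * I := mul_nonneg zero_le_two hI0
  have hR0 : 0 ≤ C₀ * (m (L / 4) ^ 2 * (A₂ / Real.sqrt (-t)) + A₃ * (2 * I * (A₄ / ‖x‖))) :=
    mul_nonneg hC₀.le (add_nonneg (mul_nonneg (sq_nonneg _) (div_nonneg hA₂.le (Real.sqrt_nonneg _)))
      (mul_nonneg hA₃.le (mul_nonneg h2I (div_nonneg hA₄.le (norm_nonneg _)))))
  have hmain : ENNReal.ofReal ‖u t x‖ ≤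
      ENNReal.ofReal (C₀ * (m (L / 4) ^ 2 * (A₂ / Real.sqrt (-t)) + A₃ * (2 * I * (A₄ / ‖x‖)))) := by
    calc ENNReal.ofReal ‖u t x‖
        ≤ ENNReal.ofReal C₀ * ∫⁻ τ in Iio t, ∫⁻ y, ENNReal.ofReal (k τ y * ‖u τ y‖ ^ 2) := h1'
      _ ≤ ENNReal.ofReal C₀ * (ENNReal.ofReal (m (L / 4) ^ 2) * ENNReal.ofReal (A₂ / Real.sqrt (-t)) +
            ENNReal.ofReal A₃ * (2 * ENNReal.ofReal I * ENNReal.ofReal (A₄ / ‖x‖))) :=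
          mul_le_mul' le_rfl (hC.trans (add_le_add le_rfl (mul_le_mul' le_rfl hJ)))
      _ = ENNReal.ofReal (C₀ * (m (L / 4) ^ 2 * (A₂ / Real.sqrt (-t)) + A₃ * (2 * I * (A₄ / ‖x‖)))) := by
          have h2e : (2 : ℝ≥0∞) * ENNReal.ofReal I = ENNReal.ofReal (2 * I) := by
            rw [ENNReal.ofReal_mul zero_le_two, ENNReal.ofReal_ofNat]
          rw [h2e, ← ENNReal.ofReal_mul h2I,
            ← ENNReal.ofReal_mul hA₃.le, ← ENNReal.ofReal_mul (sq_nonneg _),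
            ← ENNReal.ofReal_add (mul_nonneg (sq_nonneg _) (div_nonneg hA₂.le (Real.sqrt_nonneg _)))
              (mul_nonneg hA₃.le (mul_nonneg h2I (div_nonneg hA₄.le (norm_nonneg _)))),
            ← ENNReal.ofReal_mul hC₀.le]
  have hreal : ‖u t x‖ ≤ C₀ * (m (L / 4) ^ 2 * (A₂ / Real.sqrt (-t)) + A₃ * (2 * I * (A₄ / ‖x‖))) :=
    (ENNReal.ofReal_le_ofReal_iff hR0).1 hmain
  have hs₀' : Real.sqrt (-t) ≠ 0 := hs₀.ne'
  have hX' : ‖x‖ ≠ 0 := hX.ne'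
  have hsx : Real.sqrt (-t) / ‖x‖ ≤ 1 / L := by
    rw [div_le_div_iff₀ hX hL, one_mul, mul_comm]
    exact hx
  calc Real.sqrt (-t) * ‖u t x‖
      ≤ Real.sqrt (-t) * (C₀ * (m (L / 4) ^ 2 * (A₂ / Real.sqrt (-t)) + A₃ * (2 * I * (A₄ / ‖x‖)))) :=
        mul_le_mul_of_nonneg_left hreal hs₀.le
    _ = C₀ * A₂ * m (L / 4) ^ 2 + 2 * C₀ * A₃ * A₄ * I * (Real.sqrt (-t) / ‖x‖) := by
        field_simp
    _ ≤ C₀ * A₂ * m (L / 4) ^ 2 + 2 * C₀ * A₃ * A₄ * I * (1 / L) :=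
        add_le_add le_rfl (mul_le_mul_of_nonneg_left hsx (mul_nonneg (by positivity) hI0))
    _ = C₀ * A₂ * m (L / 4) ^ 2 + 2 * C₀ * A₃ * A₄ / L * I := by ring


/-! ## B2 from T1–T5 -/

/-- **Stub T6 — the symmetry-free Oseen bootstrap B2 from the five analysis stubs T1–T5** (registered stub
of line `blowdown-kills-pitch`, crux stmt-NavierStokesRegularity-4053): a Type-I ancient mild solution `u ∈ A_C`
whose scale-invariant size `√(−t)‖u(t,x)‖` is small outside the paraboloids `‖x‖ ≥ R√(−t)` obeys the space–time
Type-I bound `‖u(t,x)‖ ≤ K/(‖x‖ + √(−t))` (Pineau–Vicol's class (1.10)). The envelope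
`m(L) = sup{√(−t)‖u(t,x)‖ : ‖x‖ ≥ L√(−t)}` is antitone, bounded by `C` and tends to `0`; the master inequality
(`master_inequality_at`, from T1–T4) and T5 give `m(L) ≤ K/L`, and `‖u‖ ≤ C/√(−t)` completes the bound with
constant `2 max C K`. [cite: KochNadirashviliSereginSverak2009, §4 (4.3)–(4.4) (arXiv:0709.3599 p. 8)] -/
theorem stub_oseenBootstrap_of :
    (∃ C₀ : ℝ, 0 < C₀ ∧ ∀ (C : ℝ) (u : ℝ → E3 → E3), IsTypeIAncientMild C u → ∀ t < 0, ∀ x : E3,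
      ENNReal.ofReal ‖u t x‖ ≤ ENNReal.ofReal C₀ *
        ∫⁻ τ in Set.Iio t, ∫⁻ y, ENNReal.ofReal ((t - τ + ‖x - y‖ ^ 2)⁻¹ ^ 2 * ‖u τ y‖ ^ 2)) →
    (∃ A : ℝ, 0 < A ∧ ∀ t < 0, ∀ x : E3,
      ∫⁻ τ in Set.Iio t, ∫⁻ y, ENNReal.ofReal ((t - τ + ‖x - y‖ ^ 2)⁻¹ ^ 2 * (-τ)⁻¹) ≤
        ENNReal.ofReal (A / Real.sqrt (-t))) →
    (∃ A : ℝ, 0 < A ∧ ∀ x : E3, x ≠ 0 → ∀ σ : ℝ, 0 < σ → ∀ (a : ℝ) (F : ℝ → ℝ≥0∞), Measurable F →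
      ∫⁻ y in {y : E3 | |inner ℝ y x| ≤ a * ‖x‖},
          ENNReal.ofReal ((σ + ‖x - y‖ ^ 2)⁻¹ ^ 2) * F (inner ℝ y x / ‖x‖) ≤
        ENNReal.ofReal A * ∫⁻ r in Set.Icc (-a) a, ENNReal.ofReal ((σ + (‖x‖ - r) ^ 2)⁻¹) * F r) →
    (∃ A : ℝ, 0 < A ∧ ∀ s₀ : ℝ, 0 < s₀ → ∀ X : ℝ, 0 < X → ∀ ρ : ℝ, |ρ| * (4 * Real.sqrt s₀) ≤ X →
      ∫⁻ s in Set.Ioi s₀, ENNReal.ofReal ((Real.sqrt s)⁻¹ * (s - s₀ + (X - ρ * Real.sqrt s) ^ 2)⁻¹) ≤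
        ENNReal.ofReal (A / X)) →
    (∀ (m : ℝ → ℝ) (Cm A₁ A₂ : ℝ), Antitone m → (∀ L, 0 ≤ m L) → (∀ L, m L ≤ Cm) → 0 ≤ A₁ → 0 ≤ A₂ →
      Tendsto m atTop (𝓝 0) →
      (∀ L, 0 < L → m L ≤ A₁ * m (L / 4) ^ 2 + A₂ / L * ∫ s in (0:ℝ)..(L / 4), m s ^ 2) →
      ∃ K : ℝ, ∀ L, 0 < L → m L ≤ K / L) →
    ∀ (C : ℝ) (u : ℝ → E3 → E3), IsTypeIAncientMild C u →
      (∀ ε > 0, ∃ R : ℝ, ∀ t < 0, ∀ x, R * Real.sqrt (-t) ≤ ‖x‖ → Real.sqrt (-t) * ‖u t x‖ ≤ ε) →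
      ∃ K : ℝ, HasTypeIDecay K u := by
  rintro ⟨C₀, hC₀, h1⟩ ⟨A₂, hA₂, h2⟩ ⟨A₃, hA₃, h3⟩ ⟨A₄, hA₄, h4⟩ h5 C u hu hff
  -- the scale-invariant size and its far-field envelope
  have hw0 : ∀ t < 0, ∀ x : EuclideanSpace ℝ (Fin 3), 0 ≤ Real.sqrt (-t) * ‖u t x‖ := fun t _ x =>
    mul_nonneg (Real.sqrt_nonneg _) (norm_nonneg _)
  have hwC : ∀ t < 0, ∀ x : EuclideanSpace ℝ (Fin 3), Real.sqrt (-t) * ‖u t x‖ ≤ C := by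
    intro t ht x
    have hs : 0 < Real.sqrt (-t) := Real.sqrt_pos.2 (neg_pos.2 ht)
    have h := hu.norm_le ht x
    rw [le_div_iff₀ hs] at h
    simpa only [mul_comm] using h
  obtain ⟨m, hm⟩ : ∃ m : ℝ → ℝ, ∀ L, m L =
      sSup ((fun p : ℝ × EuclideanSpace ℝ (Fin 3) => Real.sqrt (-p.1) * ‖u p.1 p.2‖) ''
        {p | p.1 < 0 ∧ L * Real.sqrt (-p.1) ≤ ‖p.2‖}) := ⟨_, fun L => rfl⟩
  obtain ⟨hub, hmC, hm0, hanti, hle⟩ :=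
    envelope_basic (w := fun t x => Real.sqrt (-t) * ‖u t x‖) hw0 hwC hm
  -- `m → 0` (the far-field hypothesis)
  have htend : Tendsto m atTop (𝓝 0) := by
    rw [Metric.tendsto_atTop]
    intro ε hε
    obtain ⟨R, hR⟩ := hff (ε / 2) (half_pos hε)
    refine ⟨R, fun L hL => ?_⟩
    rw [Real.dist_eq, sub_zero, abs_of_nonneg (hm0 L)]
    have h := hle R (ε / 2) fun t ht x hx => hR t ht x hx
    linarith [hanti hL]
  -- the master inequality (T1–T4)
  have hmaster : ∀ L, 0 < L → m L ≤ C₀ * A₂ * m (L / 4) ^ 2 +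
      2 * C₀ * A₃ * A₄ / L * ∫ s in (0:ℝ)..(L / 4), m s ^ 2 := by
    intro L hL
    refine hle L _ fun t ht x hx => ?_
    exact master_inequality_at hC₀ hA₂ hA₃ hA₄ (h1 C u hu) h2 h3 h4 hanti.measurable hm0 hanti hub hL ht hx
  -- the critical rate (T5)
  obtain ⟨K, hK⟩ := h5 m C (C₀ * A₂) (2 * C₀ * A₃ * A₄) hanti hm0 hmC (by positivity) (by positivity)
    htend hmaster
  -- the space–time bound with constant `2 max C K`
  refine ⟨2 * max C K, fun t ht x => ?_⟩
  have hs : 0 < Real.sqrt (-t) := Real.sqrt_pos.2 (neg_pos.2 ht)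
  have hC0 : 0 ≤ C := hu.nonneg
  have hden : 0 < ‖x‖ + Real.sqrt (-t) := by positivity
  rw [le_div_iff₀ hden]
  have hb1 : ‖u t x‖ * Real.sqrt (-t) ≤ max C K := by
    rw [mul_comm]
    exact (hwC t ht x).trans (le_max_left _ _)
  have hb2 : ‖u t x‖ * ‖x‖ ≤ max C K := by
    rcases eq_or_ne x 0 with rfl | hx0
    · rw [norm_zero, mul_zero]
      exact hC0.trans (le_max_left _ _)
    · have hX : 0 < ‖x‖ := norm_pos_iff.2 hx0
      have hLpos : 0 < ‖x‖ / Real.sqrt (-t) := div_pos hX hs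
      have hxL : ‖x‖ / Real.sqrt (-t) * Real.sqrt (-t) ≤ ‖x‖ := by rw [div_mul_cancel₀ _ hs.ne']
      have h1 := hub _ t ht x hxL
      have h2 := hK _ hLpos
      have h3 : Real.sqrt (-t) * ‖u t x‖ ≤ K / (‖x‖ / Real.sqrt (-t)) := h1.trans h2
      rw [div_div_eq_mul_div, le_div_iff₀ hX] at h3
      have h4 : Real.sqrt (-t) * (‖u t x‖ * ‖x‖) ≤ Real.sqrt (-t) * K := by linarith [h3]
      exact (le_of_mul_le_mul_left h4 hs).trans (le_max_right _ _)
  calc ‖u t x‖ * (‖x‖ + Real.sqrt (-t)) = ‖u t x‖ * ‖x‖ + ‖u t x‖ * Real.sqrt (-t) := by ring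
    _ ≤ max C K + max C K := add_le_add hb2 hb1
    _ = 2 * max C K := by ring

end Summit.NavierStokesRegularity.NavierStokesRegularity.Theorems.SymmetryModuliCountSymmetricLiouville

end
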